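import Summits.Ventures.HodgeRepro.Tier3OrbitRational

/-!
# Base change of exterior powers and the Galois action on coordinate wedges — the WEDGE STEP of
LEMMA-R-RESIDUE.md §5 (`H¹ → H^{2p} = ∧^{2p} H¹`) on the kernel

Blind re-derivation cell `pub-hodge-repro`, seat `t3-p4` (Tier 3, T3.5 for T3.4).  Target tree path
`lean/Summits/Ventures/HodgeRepro/Tier3WedgeBaseChange.lean`; imports Mathlib and the cell's `Tier3OrbitRational`
(for `rTensor_smul` and the final corollary).

WHAT THIS FILE STATES.  LEMMA-R-RESIDUE.md v7 §5 / §8 left ONE sentence of the non-vanishing argument on paper: «the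
coordinate wedges `e_U = ∧_{(j,x) ∈ U} e_{(j,x)}` of the Galois-equivariant eigenbasis of `H¹ ⊗ F` (Tier3EigenBasis)
form a basis of `H^{2p} ⊗ F = (∧^{2p} H¹) ⊗ F` on which `τ ⊗ 1` acts by `e_U ↦ ε(τ, U) · e_{τ∘U}`, `ε = ±1` the sign
of the permutation `τ` induces on the ordered set `U`» — textbook multilinear algebra (base change of exterior powers),
which g2 assessed as not in Mathlib.  Here it is, for an arbitrary field extension `K/F₀` and `F₀`-space `V`:

* `exists_wedgeBaseChange`: a `K`-linear isomorphism `Φ : K ⊗[F₀] ⋀[F₀]^n V ≃ ⋀[K]^n (K ⊗[F₀] V)` with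
  `Φ (k ⊗ (v₁ ∧ ⋯ ∧ vₙ)) = k • ((1 ⊗ v₁) ∧ ⋯ ∧ (1 ⊗ vₙ))` (the universal property of `⋀[F₀]^n V` over `F₀`, lifted to
  `K` by `LinearMap.liftBaseChange`; bijective because it carries the base change of the wedge basis of an `F₀`-basis
  of `V` to the wedge basis of its base change — `Module.Basis.exteriorPower`, `Module.Basis.baseChange`);
* `wedgeBaseChange_rTensor_symm_ιMulti`: under any such `Φ`, `σ ⊗ 1` on `K ⊗ ⋀^n V` is the `σ`-semilinear map
  `w₁ ∧ ⋯ ∧ wₙ ↦ (σ ⊗ 1) w₁ ∧ ⋯ ∧ (σ ⊗ 1) wₙ` of `⋀[K]^n (K ⊗ V)` (proved coordinate by coordinate from the pure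
  tensors, by additivity and `σ`-semilinearity of both sides);
* `exists_perm_smul_enum`: for an `n`-subset `s` of a linearly ordered `G`-set, the increasing enumeration of `σ • s`
  composed with a permutation `π` of `Fin n` is `σ •` the enumeration of `s` — `ε(σ, s) := sign π`;
* `exists_wedge_basis_equiv` / `exists_equivariant_wedge_basis`: if `e` is a `K`-basis of `K ⊗ V` with
  `(σ ⊗ 1) e_i = e_{σ • i}`, the coordinate wedges `E_s := Φ⁻¹ (e_{s₁} ∧ ⋯ ∧ e_{sₙ})` (`s₁ < ⋯ < sₙ`) form a `K`-basis
  of `K ⊗ ⋀[F₀]^n V` with `(σ ⊗ 1) E_s = ε(σ, s) • E_{σ • s}`, `ε(σ, s) ∈ {1, −1}` — the index set is Mathlib's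
  `Set.powersetCard ι n` with its `MulAction`;
* `exists_rational_wedge_of_orbit`: the composite with `Tier3OrbitRational.exists_rational_of_orbit_span` — LEMMA-R-RESIDUE
  §5 (i′)–(iv′) at the level of `⋀^n`: a non-zero rational vector of a Galois-stable subspace with a non-zero
  coefficient on every coordinate wedge of a Galois orbit of `n`-subsets.

HONESTY.  Linear algebra on Mathlib over the cell's own Tier-3 modules; nothing here is about Hodge classes beyond the
abstract statement.  HC_CM is NOT proved by anyone in this repository.
-/

set_option autoImplicit false

open TensorProduct

namespace HodgeRepro.Tier3

variable {F₀ K : Type*} [Field F₀] [Field K] [Algebra F₀ K]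
variable {V : Type*} [AddCommGroup V] [Module F₀ V]

/-- **Base change of exterior powers.**  There is a `K`-linear isomorphism
`K ⊗[F₀] ⋀[F₀]^n V ≃ ⋀[K]^n (K ⊗[F₀] V)` carrying `k ⊗ (v₁ ∧ ⋯ ∧ vₙ)` to `k • ((1 ⊗ v₁) ∧ ⋯ ∧ (1 ⊗ vₙ))`. -/
theorem exists_wedgeBaseChange (n : ℕ) :
    ∃ Φ : K ⊗[F₀] ⋀[F₀]^n V ≃ₗ[K] ⋀[K]^n (K ⊗[F₀] V),
      ∀ (k : K) (v : Fin n → V),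
        Φ (k ⊗ₜ[F₀] exteriorPower.ιMulti F₀ n v) =
          k • exteriorPower.ιMulti K n (fun i => (1 : K) ⊗ₜ[F₀] v i) := by
  classical
  -- the `F₀`-structure of the `K`-exterior power (Mathlib's instances are found only when named)
  letI : IsScalarTower F₀ K (ExteriorAlgebra K (K ⊗[F₀] V)) := RingCon.instIsScalarTowerQuotient _
  letI : IsScalarTower F₀ K (⋀[K]^n (K ⊗[F₀] V)) := Submodule.isScalarTower _
  -- the `K`-alternating map `ιMulti` seen over `F₀`
  let ψ₀ : (K ⊗[F₀] V) [⋀^Fin n]→ₗ[F₀] ⋀[K]^n (K ⊗[F₀] V) :=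
    { (exteriorPower.ιMulti K n).toMultilinearMap.restrictScalars F₀ with
      map_eq_zero_of_eq' := fun v i j h hij => (exteriorPower.ιMulti K n).map_eq_zero_of_eq v h hij }
  -- `(v_i) ↦ (1 ⊗ v_1) ∧ ⋯ ∧ (1 ⊗ v_n)`, an `F₀`-alternating map on `V`
  let ψalt : V [⋀^Fin n]→ₗ[F₀] ⋀[K]^n (K ⊗[F₀] V) := ψ₀.compLinearMap (TensorProduct.mk F₀ K V 1)
  have hψalt : ∀ v : Fin n → V, ψalt v = exteriorPower.ιMulti K n (fun i => (1 : K) ⊗ₜ[F₀] v i) := fun v => rfl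
  -- the induced `F₀`-linear map on `⋀[F₀]^n V` and its `K`-linear lift to the base change
  let ψ : ⋀[F₀]^n V →ₗ[F₀] ⋀[K]^n (K ⊗[F₀] V) := exteriorPower.alternatingMapLinearEquiv ψalt
  let Φ₀ : K ⊗[F₀] ⋀[F₀]^n V →ₗ[K] ⋀[K]^n (K ⊗[F₀] V) := ψ.liftBaseChange K
  have hΦ₀ : ∀ (k : K) (v : Fin n → V),
      Φ₀ (k ⊗ₜ[F₀] exteriorPower.ιMulti F₀ n v) =
        k • exteriorPower.ιMulti K n (fun i => (1 : K) ⊗ₜ[F₀] v i) := by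
    intro k v
    rw [← hψalt]
    simp only [Φ₀, ψ, LinearMap.liftBaseChange_tmul, exteriorPower.alternatingMapLinearEquiv_apply_ιMulti]
  -- bijectivity: `Φ₀` carries the base change of the wedge basis of a basis `b` of `V` to the wedge basis of `1 ⊗ b`
  letI : LinearOrder (Module.Free.ChooseBasisIndex F₀ V) := IsWellOrder.linearOrder WellOrderingRel
  let b : Module.Basis (Module.Free.ChooseBasisIndex F₀ V) F₀ V := Module.Free.chooseBasis F₀ V
  let B₁ := (b.exteriorPower n).baseChange K
  let B₂ := (b.baseChange K).exteriorPower n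
  have hB : ∀ s, Φ₀ (B₁ s) = B₂ s := by
    intro s
    simp only [B₁, B₂, Module.Basis.baseChange_apply, exteriorPower.basis_apply,
      exteriorPower.ιMulti_family, hΦ₀, one_smul]
    congr 1
    funext i
    exact (Module.Basis.baseChange_apply K b _).symm
  have hΦeq : Φ₀ = (B₁.equiv B₂ (Equiv.refl _)).toLinearMap :=
    B₁.ext fun s => by rw [hB, LinearEquiv.coe_coe, Module.Basis.equiv_apply, Equiv.refl_apply]
  have hbij : Function.Bijective Φ₀ := by
    rw [hΦeq]
    exact (B₁.equiv B₂ (Equiv.refl _)).bijective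
  exact ⟨LinearEquiv.ofBijective Φ₀ hbij, hΦ₀⟩

/-- **The Galois action through the base-change isomorphism.**  Under any isomorphism `Φ` as in
`exists_wedgeBaseChange`, the `F₀`-linear map `σ ⊗ 1` of `K ⊗ ⋀[F₀]^n V` corresponds to the `σ`-semilinear map
`w₁ ∧ ⋯ ∧ wₙ ↦ (σ ⊗ 1) w₁ ∧ ⋯ ∧ (σ ⊗ 1) wₙ` of `⋀[K]^n (K ⊗[F₀] V)`.  (Proof: both sides are additive and
`σ`-semilinear in each coordinate `wᵢ`, and agree when every `wᵢ` is a pure tensor `1 ⊗ vᵢ`.) -/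
theorem wedgeBaseChange_rTensor_symm_ιMulti (n : ℕ)
    (Φ : K ⊗[F₀] ⋀[F₀]^n V ≃ₗ[K] ⋀[K]^n (K ⊗[F₀] V))
    (hΦ : ∀ (k : K) (v : Fin n → V),
      Φ (k ⊗ₜ[F₀] exteriorPower.ιMulti F₀ n v) =
        k • exteriorPower.ιMulti K n (fun i => (1 : K) ⊗ₜ[F₀] v i))
    (σ : K ≃ₐ[F₀] K) (w : Fin n → K ⊗[F₀] V) :
    Φ (LinearMap.rTensor (⋀[F₀]^n V) σ.toLinearMap (Φ.symm (exteriorPower.ιMulti K n w))) =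
      exteriorPower.ιMulti K n (LinearMap.rTensor V σ.toLinearMap ∘ w) := by
  classical
  -- the transported map `S := Φ ∘ (σ ⊗ 1) ∘ Φ⁻¹`: additive and `σ`-semilinear
  set S : ⋀[K]^n (K ⊗[F₀] V) → ⋀[K]^n (K ⊗[F₀] V) :=
    fun x => Φ (LinearMap.rTensor (⋀[F₀]^n V) σ.toLinearMap (Φ.symm x)) with hS
  have hSadd : ∀ x y, S (x + y) = S x + S y := by
    intro x y
    simp only [hS, map_add]
  have hSsmul : ∀ (c : K) (x), S (c • x) = σ c • S x := by
    intro c x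
    simp only [hS, LinearEquiv.map_smul, rTensor_smul]
  have hSzero : S 0 = 0 := by
    simp only [hS, map_zero]
  -- the base case: every coordinate of the form `1 ⊗ v`
  have hbase : ∀ v : Fin n → V,
      S (exteriorPower.ιMulti K n (fun i => (1 : K) ⊗ₜ[F₀] v i)) =
        exteriorPower.ιMulti K n (LinearMap.rTensor V σ.toLinearMap ∘ fun i => (1 : K) ⊗ₜ[F₀] v i) := by
    intro v
    have h1 : exteriorPower.ιMulti K n (fun i => (1 : K) ⊗ₜ[F₀] v i) =
        Φ ((1 : K) ⊗ₜ[F₀] exteriorPower.ιMulti F₀ n v) := by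
      rw [hΦ, one_smul]
    have h2 : (LinearMap.rTensor V σ.toLinearMap ∘ fun i => (1 : K) ⊗ₜ[F₀] v i) =
        fun i => (1 : K) ⊗ₜ[F₀] v i := by
      funext i
      simp only [Function.comp_apply, LinearMap.rTensor_tmul, AlgEquiv.toLinearMap_apply, map_one]
    rw [h2, h1]
    simp only [hS, LinearEquiv.symm_apply_apply, LinearMap.rTensor_tmul, AlgEquiv.toLinearMap_apply, map_one]
  -- induction on the number of coordinates that are allowed to be arbitrary
  suffices key : ∀ m : ℕ, ∀ w : Fin n → K ⊗[F₀] V,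
      (∀ j : Fin n, m ≤ j.val → ∃ v : V, w j = (1 : K) ⊗ₜ[F₀] v) →
      S (exteriorPower.ιMulti K n w) = exteriorPower.ιMulti K n (LinearMap.rTensor V σ.toLinearMap ∘ w) by
    exact key n w (fun j hj => absurd (lt_of_le_of_lt hj j.isLt) (lt_irrefl n))
  intro m
  induction m with
  | zero =>
    intro w hw
    choose v hv using fun j => hw j (Nat.zero_le _)
    have hw' : w = fun j => (1 : K) ⊗ₜ[F₀] v j := funext hv
    rw [hw']
    exact hbase v
  | succ m ih =>
    intro w hw
    by_cases hm : m < n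
    · set i : Fin n := ⟨m, hm⟩ with hi
      have hupd : ∀ x : K ⊗[F₀] V,
          S (exteriorPower.ιMulti K n (Function.update w i x)) =
            exteriorPower.ιMulti K n (LinearMap.rTensor V σ.toLinearMap ∘ Function.update w i x) := by
        intro x
        induction x using TensorProduct.induction_on with
        | zero =>
          rw [AlternatingMap.map_update_zero, hSzero, Function.comp_update, map_zero,
            AlternatingMap.map_update_zero]
        | tmul c v =>
          have hc : c ⊗ₜ[F₀] v = c • ((1 : K) ⊗ₜ[F₀] v) := by
            rw [TensorProduct.smul_tmul', smul_eq_mul, mul_one]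
          have hih := ih (Function.update w i ((1 : K) ⊗ₜ[F₀] v)) (by
            intro j hj
            by_cases hji : j = i
            · exact ⟨v, by rw [hji, Function.update_self]⟩
            · rw [Function.update_of_ne hji]
              apply hw j
              rcases Nat.lt_or_ge m j.val with h | h
              · exact h
              · exact absurd (Fin.ext (le_antisymm h hj) : j = i) hji)
          rw [hc, AlternatingMap.map_update_smul, hSsmul, hih, Function.comp_update, Function.comp_update,
            rTensor_smul, AlternatingMap.map_update_smul]
        | add x y hx hy =>
          rw [AlternatingMap.map_update_add, hSadd, hx, hy, Function.comp_update, Function.comp_update,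
            Function.comp_update, map_add, AlternatingMap.map_update_add]
      have := hupd (w i)
      rwa [Function.update_eq_self] at this
    · exact ih w (fun j hj => absurd (lt_of_le_of_lt hj j.isLt) hm)

open Set.powersetCard in
/-- **The permutation by which `σ` acts on an enumerated `n`-subset.**  For `s ⊆ ι` of size `n` in a linearly ordered
`G`-set and `σ : G`, some permutation `π` of `Fin n` satisfies `enum (σ • s) (π j) = σ • enum s j`, where `enum t`
is the increasing enumeration `Fin n ↪o ι` of `t` (`Set.powersetCard.ofFinEmbEquiv.symm t`). -/
theorem exists_perm_smul_enum {ι : Type*} [LinearOrder ι] {G : Type*} [Group G] [MulAction G ι] (n : ℕ)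
    (σ : G) (s : Set.powersetCard ι n) :
    ∃ π : Equiv.Perm (Fin n), ∀ j : Fin n,
      ofFinEmbEquiv.symm (σ • s) (π j) = σ • ofFinEmbEquiv.symm s j := by
  classical
  set f : Fin n → ι := fun j => σ • ofFinEmbEquiv.symm s j with hf
  have hfinj : Function.Injective f := fun a b h =>
    (ofFinEmbEquiv.symm s).injective (MulAction.injective σ h)
  set g : Fin n → ι := fun j => ofFinEmbEquiv.symm (σ • s) j with hg
  have hginj : Function.Injective g := (ofFinEmbEquiv.symm (σ • s)).injective
  have hrange : Set.range f = Set.range g := by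
    ext i
    have h1 : i ∈ Set.range f ↔ σ⁻¹ • i ∈ Set.range (ofFinEmbEquiv.symm s) := by
      constructor
      · rintro ⟨j, rfl⟩
        exact ⟨j, by simp [hf]⟩
      · rintro ⟨j, hj⟩
        exact ⟨j, by simp [hf, hj]⟩
    rw [h1, mem_range_ofFinEmbEquiv_symm_iff_mem, hg, mem_range_ofFinEmbEquiv_symm_iff_mem,
      ← mem_coe_iff, ← mem_coe_iff, coe_smul, Finset.inv_smul_mem_iff]
  let π : Equiv.Perm (Fin n) :=
    (Equiv.ofInjective f hfinj).trans ((Equiv.setCongr hrange).trans (Equiv.ofInjective g hginj).symm)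
  refine ⟨π, fun j => ?_⟩
  change g (π j) = f j
  simp only [π, Equiv.trans_apply]
  rw [Equiv.apply_ofInjective_symm hginj]
  rfl

variable {ι : Type*} [LinearOrder ι] [MulAction (K ≃ₐ[F₀] K) ι]

/-- **Coordinate wedges of an equivariant basis are equivariant up to sign.**  Let `Φ` be a base-change isomorphism as
in `exists_wedgeBaseChange` and `e` a `K`-basis of `K ⊗[F₀] V` with `(σ ⊗ 1) e_i = e_{σ • i}`.  The coordinate wedges
`E_s := Φ⁻¹ (e_{s₁} ∧ ⋯ ∧ e_{sₙ})` (`s = {s₁ < ⋯ < sₙ}`, Mathlib's `Module.Basis.exteriorPower` transported by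
`Φ.symm`) satisfy `(σ ⊗ 1) E_s = ε(σ, s) • E_{σ • s}` with `ε(σ, s) ∈ {1, −1}` (the sign of the permutation `σ`
induces on the ordered set `s`, `exists_perm_smul_enum`) — LEMMA-R-RESIDUE.md v7 §5 CORRECTION, «`(τ ⊗ 1) e_U =
ε(τ, U) · e_{τ∘U}`». -/
theorem exists_wedge_basis_equiv (n : ℕ)
    (Φ : K ⊗[F₀] ⋀[F₀]^n V ≃ₗ[K] ⋀[K]^n (K ⊗[F₀] V))
    (hΦ : ∀ (k : K) (v : Fin n → V),
      Φ (k ⊗ₜ[F₀] exteriorPower.ιMulti F₀ n v) =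
        k • exteriorPower.ιMulti K n (fun i => (1 : K) ⊗ₜ[F₀] v i))
    (e : Module.Basis ι K (K ⊗[F₀] V))
    (hequiv : ∀ (σ : K ≃ₐ[F₀] K) (i : ι), LinearMap.rTensor V σ.toLinearMap (e i) = e (σ • i)) :
    ∃ u : (K ≃ₐ[F₀] K) → Set.powersetCard ι n → K,
      (∀ σ s, u σ s = 1 ∨ u σ s = -1) ∧
      ∀ (σ : K ≃ₐ[F₀] K) (s : Set.powersetCard ι n),
        LinearMap.rTensor (⋀[F₀]^n V) σ.toLinearMap ((e.exteriorPower n).map Φ.symm s) =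
          u σ s • (e.exteriorPower n).map Φ.symm (σ • s) := by
  classical
  choose π hπ using fun (σ : K ≃ₐ[F₀] K) (s : Set.powersetCard ι n) => exists_perm_smul_enum n σ s
  refine ⟨fun σ s => ((Equiv.Perm.sign (π σ s) : ℤ) : K), fun σ s => ?_, fun σ s => ?_⟩
  · rcases Int.units_eq_one_or (Equiv.Perm.sign (π σ s)) with h | h <;> simp [h]
  · apply Φ.injective
    rw [LinearEquiv.map_smul, Module.Basis.map_apply, Module.Basis.map_apply, LinearEquiv.apply_symm_apply,
      exteriorPower.basis_apply, exteriorPower.basis_apply, exteriorPower.ιMulti_family,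
      exteriorPower.ιMulti_family, wedgeBaseChange_rTensor_symm_ιMulti n Φ hΦ σ]
    have h1 : LinearMap.rTensor V σ.toLinearMap ∘ (e ∘ Set.powersetCard.ofFinEmbEquiv.symm s) =
        (e ∘ Set.powersetCard.ofFinEmbEquiv.symm (σ • s)) ∘ (π σ s) := by
      funext j
      simp only [Function.comp_apply, hequiv, hπ]
    rw [h1, AlternatingMap.map_perm, Units.smul_def, ← Int.cast_smul_eq_zsmul K]

/-- **The equivariant wedge basis**, existentially: from a Galois-equivariant `K`-basis `e` of `K ⊗[F₀] V` one gets a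
`K`-basis `E` of `K ⊗[F₀] ⋀[F₀]^n V` indexed by the `n`-subsets of `ι` with `(σ ⊗ 1) E_s = ε(σ, s) • E_{σ • s}`,
`ε(σ, s) ∈ {1, −1}`, and `Φ (E_s) = e_{s₁} ∧ ⋯ ∧ e_{sₙ}` for a base-change isomorphism `Φ`. -/
theorem exists_equivariant_wedge_basis (n : ℕ) (e : Module.Basis ι K (K ⊗[F₀] V))
    (hequiv : ∀ (σ : K ≃ₐ[F₀] K) (i : ι), LinearMap.rTensor V σ.toLinearMap (e i) = e (σ • i)) :
    ∃ (E : Module.Basis (Set.powersetCard ι n) K (K ⊗[F₀] ⋀[F₀]^n V))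
      (Φ : K ⊗[F₀] ⋀[F₀]^n V ≃ₗ[K] ⋀[K]^n (K ⊗[F₀] V))
      (u : (K ≃ₐ[F₀] K) → Set.powersetCard ι n → K),
      (∀ (k : K) (v : Fin n → V),
        Φ (k ⊗ₜ[F₀] exteriorPower.ιMulti F₀ n v) =
          k • exteriorPower.ιMulti K n (fun i => (1 : K) ⊗ₜ[F₀] v i)) ∧
      (∀ s, Φ (E s) = exteriorPower.ιMulti_family K n e s) ∧
      (∀ σ s, u σ s = 1 ∨ u σ s = -1) ∧
      ∀ (σ : K ≃ₐ[F₀] K) (s : Set.powersetCard ι n),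
        LinearMap.rTensor (⋀[F₀]^n V) σ.toLinearMap (E s) = u σ s • E (σ • s) := by
  obtain ⟨Φ, hΦ⟩ := exists_wedgeBaseChange (F₀ := F₀) (K := K) (V := V) n
  obtain ⟨u, hu, hE⟩ := exists_wedge_basis_equiv n Φ hΦ e hequiv
  refine ⟨(e.exteriorPower n).map Φ.symm, Φ, u, hΦ, fun s => ?_, hu, hE⟩
  rw [Module.Basis.map_apply, LinearEquiv.apply_symm_apply, exteriorPower.basis_apply]

variable [FiniteDimensional F₀ K] [IsGalois F₀ K]

/-- **LEMMA-R-RESIDUE.md §5 (i′)–(iv′) at the level of `⋀^n`.**  Let `e` be a Galois-equivariant `K`-basis of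
`K ⊗[F₀] V` (Tier3EigenBasis), `E` its wedge basis of `K ⊗[F₀] ⋀[F₀]^n V` (any `E`, `Φ` as in
`exists_equivariant_wedge_basis`), `W ≤ ⋀[F₀]^n V` an `F₀`-subspace and `P` a Galois-stable set of `n`-subsets whose
wedges lie in `W ⊗ K` (the Pohlmann lines).  Then for every `s₀ ∈ P` there is a NON-ZERO `η ∈ W` with `1 ⊗ η` in the
span of the wedges of the orbit of `s₀` and with a non-zero coefficient on EVERY wedge of that orbit. -/
theorem exists_rational_wedge_of_orbit (n : ℕ) (e : Module.Basis ι K (K ⊗[F₀] V))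
    (hequiv : ∀ (σ : K ≃ₐ[F₀] K) (i : ι), LinearMap.rTensor V σ.toLinearMap (e i) = e (σ • i))
    (Φ : K ⊗[F₀] ⋀[F₀]^n V ≃ₗ[K] ⋀[K]^n (K ⊗[F₀] V))
    (hΦ : ∀ (k : K) (v : Fin n → V),
      Φ (k ⊗ₜ[F₀] exteriorPower.ιMulti F₀ n v) =
        k • exteriorPower.ιMulti K n (fun i => (1 : K) ⊗ₜ[F₀] v i))
    (W : Submodule F₀ (⋀[F₀]^n V)) (P : Set (Set.powersetCard ι n))
    (hP : ∀ (σ : K ≃ₐ[F₀] K), ∀ s ∈ P, σ • s ∈ P)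
    (hPW : ∀ s ∈ P, (e.exteriorPower n).map Φ.symm s ∈ W.baseChange K)
    (s₀ : Set.powersetCard ι n) (hs₀ : s₀ ∈ P) :
    ∃ η : ⋀[F₀]^n V, η ∈ W ∧ η ≠ 0 ∧
      (1 : K) ⊗ₜ[F₀] η ∈
        Submodule.span K ((e.exteriorPower n).map Φ.symm '' MulAction.orbit (K ≃ₐ[F₀] K) s₀) ∧
      ∀ s ∈ MulAction.orbit (K ≃ₐ[F₀] K) s₀,
        ((e.exteriorPower n).map Φ.symm).repr ((1 : K) ⊗ₜ[F₀] η) s ≠ 0 := by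
  obtain ⟨u, hu, hE⟩ := exists_wedge_basis_equiv n Φ hΦ e hequiv
  have hu0 : ∀ σ s, u σ s ≠ 0 := fun σ s => by
    rcases hu σ s with h | h <;> simp [h]
  exact exists_rational_of_orbit_span ((e.exteriorPower n).map Φ.symm) u hu0 hE W P hP hPW s₀ hs₀

end HodgeRepro.Tier3
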